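import Summits.NavierStokesRegularity.NavierStokesRegularity.Theorems.FilamentSkeletonRssDefectColumnGateVorticityAdjointCutoff
import Literature.Analysis.FluidPDE.PineauVicolWeightBounds

/-!
# Route `FilamentSkeletonRss` · negative item `NoExactProfileNearSymmetricPair` (stmt-NavierStokesRegularity-24091) — S_γ groundwork (B1):
# the ENERGY IDENTITY of the adjoint vorticity operator (the scalar majorant `|Ψ|²` is a subsolution)

Helper file (theorems only), `--supports stmt-NavierStokesRegularity-24091 --as helper`; LEAD of 23611 / registrar of 23920, lane ns-filament-21221-p1 g15.

WHY.  B2′ (= item 24091 on the symmetric-pair class) is to be proved through the flux balance `flux_balance_of_exact_profile` (p695487): an exact profile `U` and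
ANY solution `Ψ` of the adjoint equation `𝒯_U^*Ψ = 0` on the support of a cut-off have vanishing layer flux.  Step (γ-1) of the LEAD g14 design note
(`Cruxes/TransverseReductionRJ/Lines/defect_column_gate_1AR_B2_gamma.md` §1, §5(2)) asks for COMPARISON LEMMAS for scalar majorants of adjoint solutions.  This file
proves the first one, as an exact pointwise identity with no hypothesis on `U` beyond differentiability:

* `inner_vorticityAdjoint_eq` — for `Ψ ∈ C²` and `q = |Ψ|²`:
  `2⟪Ψ, 𝒯_U^*Ψ⟫ = 2‖DΨ‖²_F − Δq − Dq[v] − q − 2⟪DU·Ψ, Ψ⟫`, `v = U + ½y − α e₃×y` the frame field (`div v = 3/2`);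
* `laplacian_normSq_of_vorticityAdjoint_eq_zero` — hence at a point where `𝒯_U^*Ψ = 0`:
  `Δq + Dq[v] + q + 2⟪DU·Ψ, Ψ⟫ = 2‖DΨ‖²_F ≥ 0`, i.e. `q = |Ψ|²` is a SUBSOLUTION of `−Δ − v·∇ − (1 + 2λ_max(S))` (`S` the strain of `U`):
  `vorticityAdjoint_normSq_subsolution`;
* `inner_vorticityAdjoint_single_two` — the `e₃`-COMPONENT `h = ⟪Ψ, e₃⟫` of an adjoint field obeys the SCALAR equation
  `Δh + Dh[v] + ½h = −⟪Ψ, DU·e₃⟫ − ⟪𝒯_U^*Ψ, e₃⟫` (the rotation term drops because `e₃ × e₃ = 0`): for `𝒯_U^*Ψ = 0` the axial component solves the free scalar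
  adjoint equation `Δh + v·∇h + ½h = 0` up to the tilting source `−⟪Ψ, ∂₃U⟫` — the equation whose positive global solution (the free committor, file
  `…NoExactProfileFreeCommittor`) carries the maximum principle at all scales (file `…NoExactProfileGeneralizedMaxPrinciple`).
HONEST FRAMING: calculus identities on the NEGATIVE side of a HYPOTHETICAL filament-type rotating-self-similar blow-up route (MODEL rung); 24091/23611/23920 OPEN; nothing here
bears on Navier–Stokes regularity, which is NOT proved.
-/

set_option linter.dupNamespace false

noncomputable section

namespace Summit.NavierStokesRegularity.NavierStokesRegularity.Theorems.DefectColumnGate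

open scoped BigOperators Topology InnerProductSpace Laplacian ContDiff
open Set Function
open Literature.Analysis.FluidPDE
open Summit.NavierStokesRegularity.NavierStokesRegularity.Theorems.KelvinGate

/-- **Energy identity of the adjoint vorticity operator (pointwise).**  For `Ψ ∈ C²`, any `U`, any `y`, and `q(z) = ⟪Ψ z, Ψ z⟫`:
`2⟪Ψ(y), 𝒯_U^*Ψ(y)⟫ = 2‖DΨ(y)‖²_F − Δq(y) − Dq(y)[U(y) + ½y − α e₃×y] − q(y) − 2⟪DU(y)Ψ(y), Ψ(y)⟫`, where
`𝒯_U^*Ψ = −α(e₃×Ψ − DΨ[e₃×y]) − ½Ψ − ½DΨ[y] − ΔΨ − DΨ[U] − (DU)†Ψ` is the formal adjoint of the steady vorticity operator (`vorticity_lagrange_identity`). -/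
theorem inner_vorticityAdjoint_eq (α : ℝ) (U : EuclideanSpace ℝ (Fin 3) → EuclideanSpace ℝ (Fin 3)) {Ψ : EuclideanSpace ℝ (Fin 3) → EuclideanSpace ℝ (Fin 3)}
    (hΨ : ContDiff ℝ 2 Ψ) (y : EuclideanSpace ℝ (Fin 3)) :
    2 * ⟪Ψ y, -(α • (cross (EuclideanSpace.single 2 1) (Ψ y) - fderiv ℝ Ψ y (cross (EuclideanSpace.single 2 1) y))) - (1/2:ℝ) • Ψ y
        - (1/2:ℝ) • fderiv ℝ Ψ y y - (Δ Ψ) y - fderiv ℝ Ψ y (U y) - ContinuousLinearMap.adjoint (fderiv ℝ U y) (Ψ y)⟫_ℝ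
      = 2 * frobeniusNormSq (fderiv ℝ Ψ y) - (Δ (fun z => ⟪Ψ z, Ψ z⟫_ℝ)) y
        - fderiv ℝ (fun z => ⟪Ψ z, Ψ z⟫_ℝ) y (U y + (1/2:ℝ) • y - α • cross (EuclideanSpace.single 2 1) y)
        - ⟪Ψ y, Ψ y⟫_ℝ - 2 * ⟪fderiv ℝ U y (Ψ y), Ψ y⟫_ℝ := by
  have hΨ1 : Differentiable ℝ Ψ := hΨ.differentiable (by norm_num)
  -- `Δq = 2⟪ΔΨ, Ψ⟫ + 2‖DΨ‖²_F`
  have hL : (Δ (fun z => ⟪Ψ z, Ψ z⟫_ℝ)) y = 2 * ⟪(Δ Ψ) y, Ψ y⟫_ℝ + 2 * frobeniusNormSq (fderiv ℝ Ψ y) :=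
    laplacian_inner_self_eq hΨ y
  -- `Dq[h] = 2⟪Ψ, DΨ h⟫`
  have hD : ∀ h, fderiv ℝ (fun z => ⟪Ψ z, Ψ z⟫_ℝ) y h = 2 * ⟪Ψ y, fderiv ℝ Ψ y h⟫_ℝ := fun h => by
    rw [fderiv_inner_apply ℝ (hΨ1 y) (hΨ1 y) h, real_inner_comm (fderiv ℝ Ψ y h) (Ψ y)]; ring
  -- skewness of `e₃ ×`
  have hskew : ⟪Ψ y, cross (EuclideanSpace.single 2 1) (Ψ y)⟫_ℝ = 0 := by
    rw [cross_single_two_eq_rotGenL, rotGenL_apply, real_inner_comm, inner_rotGen_self]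
  rw [hL, hD]
  simp only [inner_sub_right, inner_add_right, inner_neg_right, inner_smul_right, map_add, map_sub, map_smul, hskew,
    ContinuousLinearMap.adjoint_inner_right, real_inner_comm (Ψ y) ((Δ Ψ) y)]
  rw [real_inner_comm (Ψ y) (fderiv ℝ U y (Ψ y))]
  ring

/-- **The scalar majorant of an adjoint solution is a subsolution.**  If `Ψ ∈ C²` solves the adjoint equation `𝒯_U^*Ψ(y) = 0` at a point `y` (no hypothesis
on `U`), then with `q = |Ψ|²`:  `Δq(y) + Dq(y)[U(y) + ½y − α e₃×y] + q(y) + 2⟪DU(y)Ψ(y), Ψ(y)⟫ = 2‖DΨ(y)‖²_F`. -/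
theorem laplacian_normSq_of_vorticityAdjoint_eq_zero (α : ℝ) {U Ψ : EuclideanSpace ℝ (Fin 3) → EuclideanSpace ℝ (Fin 3)} (hΨ : ContDiff ℝ 2 Ψ)
    {y : EuclideanSpace ℝ (Fin 3)}
    (hadj : -(α • (cross (EuclideanSpace.single 2 1) (Ψ y) - fderiv ℝ Ψ y (cross (EuclideanSpace.single 2 1) y))) - (1/2:ℝ) • Ψ y
        - (1/2:ℝ) • fderiv ℝ Ψ y y - (Δ Ψ) y - fderiv ℝ Ψ y (U y) - ContinuousLinearMap.adjoint (fderiv ℝ U y) (Ψ y) = 0) :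
    (Δ (fun z => ⟪Ψ z, Ψ z⟫_ℝ)) y + fderiv ℝ (fun z => ⟪Ψ z, Ψ z⟫_ℝ) y (U y + (1/2:ℝ) • y - α • cross (EuclideanSpace.single 2 1) y)
        + ⟪Ψ y, Ψ y⟫_ℝ + 2 * ⟪fderiv ℝ U y (Ψ y), Ψ y⟫_ℝ
      = 2 * frobeniusNormSq (fderiv ℝ Ψ y) := by
  have h := inner_vorticityAdjoint_eq α U hΨ y
  rw [hadj, inner_zero_right, mul_zero] at h
  linarith

/-- **Subsolution inequality.**  Under the hypotheses of `laplacian_normSq_of_vorticityAdjoint_eq_zero`, if the strain of `U` at `y` is bounded above along `Ψ(y)`,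
`⟪DU(y)Ψ(y), Ψ(y)⟫ ≤ s·|Ψ(y)|²`, then `q = |Ψ|²` satisfies `−Δq(y) − Dq(y)[v(y)] − (1 + 2s)·q(y) ≤ 0` (the form consumed by weak maximum principles, with the
zeroth-order coefficient `−(1 + 2s)` of the «wrong» sign: adjoint fields may GROW into the domain at rate `e^{(1+2s)·}`, cf. the design note's (γ-1)). -/
theorem vorticityAdjoint_normSq_subsolution (α : ℝ) {U Ψ : EuclideanSpace ℝ (Fin 3) → EuclideanSpace ℝ (Fin 3)} (hΨ : ContDiff ℝ 2 Ψ)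
    {y : EuclideanSpace ℝ (Fin 3)} {s : ℝ} (hs : ⟪fderiv ℝ U y (Ψ y), Ψ y⟫_ℝ ≤ s * ⟪Ψ y, Ψ y⟫_ℝ)
    (hadj : -(α • (cross (EuclideanSpace.single 2 1) (Ψ y) - fderiv ℝ Ψ y (cross (EuclideanSpace.single 2 1) y))) - (1/2:ℝ) • Ψ y
        - (1/2:ℝ) • fderiv ℝ Ψ y y - (Δ Ψ) y - fderiv ℝ Ψ y (U y) - ContinuousLinearMap.adjoint (fderiv ℝ U y) (Ψ y) = 0) :
    -(Δ (fun z => ⟪Ψ z, Ψ z⟫_ℝ)) y - fderiv ℝ (fun z => ⟪Ψ z, Ψ z⟫_ℝ) y (U y + (1/2:ℝ) • y - α • cross (EuclideanSpace.single 2 1) y)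
        - (1 + 2 * s) * ⟪Ψ y, Ψ y⟫_ℝ ≤ 0 := by
  have h := laplacian_normSq_of_vorticityAdjoint_eq_zero α hΨ hadj
  have hF : 0 ≤ frobeniusNormSq (fderiv ℝ Ψ y) := frobeniusNormSq_nonneg _
  nlinarith

/-- **The axial component of an adjoint field obeys a SCALAR equation.**  For `Ψ ∈ C²`, any `U`, any `y`, and `h(z) = ⟪Ψ z, e₃⟫`:
`⟪𝒯_U^*Ψ(y), e₃⟫ = −(Δh(y) + Dh(y)[U(y) + ½y − α e₃×y] + ½h(y)) − ⟪Ψ(y), DU(y)e₃⟫` — the rotation term `−α⟪e₃×Ψ, e₃⟫` vanishes identically, so for an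
adjoint solution the axial component solves `Δh + v·∇h + ½h = −⟪Ψ, ∂₃U⟫` (free scalar adjoint operator, tilting source). -/
theorem inner_vorticityAdjoint_single_two (α : ℝ) (U : EuclideanSpace ℝ (Fin 3) → EuclideanSpace ℝ (Fin 3)) {Ψ : EuclideanSpace ℝ (Fin 3) → EuclideanSpace ℝ (Fin 3)}
    (hΨ : ContDiff ℝ 2 Ψ) (y : EuclideanSpace ℝ (Fin 3)) :
    ⟪-(α • (cross (EuclideanSpace.single 2 1) (Ψ y) - fderiv ℝ Ψ y (cross (EuclideanSpace.single 2 1) y))) - (1/2:ℝ) • Ψ y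
        - (1/2:ℝ) • fderiv ℝ Ψ y y - (Δ Ψ) y - fderiv ℝ Ψ y (U y) - ContinuousLinearMap.adjoint (fderiv ℝ U y) (Ψ y),
        EuclideanSpace.single 2 (1:ℝ)⟫_ℝ
      = -((Δ (fun z => ⟪Ψ z, EuclideanSpace.single 2 (1:ℝ)⟫_ℝ)) y
          + fderiv ℝ (fun z => ⟪Ψ z, EuclideanSpace.single 2 (1:ℝ)⟫_ℝ) y (U y + (1/2:ℝ) • y - α • cross (EuclideanSpace.single 2 1) y)
          + (1/2:ℝ) * ⟪Ψ y, EuclideanSpace.single 2 (1:ℝ)⟫_ℝ)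
        - ⟪Ψ y, fderiv ℝ U y (EuclideanSpace.single 2 (1:ℝ))⟫_ℝ := by
  have hΨ1 : Differentiable ℝ Ψ := hΨ.differentiable (by norm_num)
  -- `Δ⟪Ψ, e₃⟫ = ⟪ΔΨ, e₃⟫`
  have hL : (Δ (fun z => ⟪Ψ z, EuclideanSpace.single 2 (1:ℝ)⟫_ℝ)) y = ⟪(Δ Ψ) y, EuclideanSpace.single 2 (1:ℝ)⟫_ℝ := by
    have hc : ContDiff ℝ 2 (fun _ : EuclideanSpace ℝ (Fin 3) => (EuclideanSpace.single 2 (1:ℝ) : EuclideanSpace ℝ (Fin 3))) := contDiff_const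
    rw [laplacian_inner_eq (EuclideanSpace.basisFun (Fin 3) ℝ) hΨ hc y, laplacian_const_eq_zero]
    simp
  -- `D⟪Ψ, e₃⟫[h] = ⟪DΨ h, e₃⟫`
  have hD : ∀ h, fderiv ℝ (fun z => ⟪Ψ z, EuclideanSpace.single 2 (1:ℝ)⟫_ℝ) y h = ⟪fderiv ℝ Ψ y h, EuclideanSpace.single 2 (1:ℝ)⟫_ℝ := fun h => by
    rw [fderiv_inner_apply ℝ (hΨ1 y) (differentiableAt_const _) h]
    simp
  -- `⟪e₃ × Ψ, e₃⟫ = 0`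
  have hskew : ⟪cross (EuclideanSpace.single 2 1) (Ψ y), EuclideanSpace.single 2 (1:ℝ)⟫_ℝ = 0 := by
    rw [cross_single_two_eq_rotGenL, inner_rotGenL_left_eq_neg, rotGenL_apply, rotGen_single_two, inner_zero_right, neg_zero]
  rw [hL, hD]
  simp only [map_add, map_sub, map_smul, inner_sub_left, inner_add_left, inner_neg_left, inner_smul_left, hskew, RCLike.conj_to_real,
    ContinuousLinearMap.adjoint_inner_left]
  ring

/-! ## Appended (LEAD g15, same day): the FORWARD twin — the energy identity of the vorticity operator itself (consumed by the barrier brick `…ExpBarrier`) -/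

/-- **Energy identity of the (forward) vorticity operator, pointwise.**  For `Ω ∈ C²`, any `U`, any `y`, and `q(z) = ⟪Ω z, Ω z⟫`:
`2⟪Ω, 𝒯_UΩ⟫ = −Δq + Dq[U + ½y − αe₃×y] + 2q − 2⟪DU·Ω, Ω⟫ + 2‖DΩ‖²_F`, where `𝒯_UΩ = α(e₃×Ω − DΩ[e₃×y]) + Ω + ½DΩ[y] − ΔΩ + DΩ[U] − DU[Ω]`
(`curl ∘ E_α`, `curl_lerayOp_of_isDivFree`). -/
theorem inner_vorticityOp_eq (α : ℝ) (U : EuclideanSpace ℝ (Fin 3) → EuclideanSpace ℝ (Fin 3)) {Ω : EuclideanSpace ℝ (Fin 3) → EuclideanSpace ℝ (Fin 3)}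
    (hΩ : ContDiff ℝ 2 Ω) (y : EuclideanSpace ℝ (Fin 3)) :
    2 * ⟪Ω y, α • (cross (EuclideanSpace.single 2 1) (Ω y) - fderiv ℝ Ω y (cross (EuclideanSpace.single 2 1) y)) + Ω y + (1/2:ℝ) • fderiv ℝ Ω y y
        - (Δ Ω) y + fderiv ℝ Ω y (U y) - fderiv ℝ U y (Ω y)⟫_ℝ
      = -(Δ (fun z => ⟪Ω z, Ω z⟫_ℝ)) y + fderiv ℝ (fun z => ⟪Ω z, Ω z⟫_ℝ) y (U y + (1/2:ℝ) • y - α • cross (EuclideanSpace.single 2 1) y)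
        + 2 * ⟪Ω y, Ω y⟫_ℝ - 2 * ⟪fderiv ℝ U y (Ω y), Ω y⟫_ℝ + 2 * frobeniusNormSq (fderiv ℝ Ω y) := by
  have hΩ1 : Differentiable ℝ Ω := hΩ.differentiable (by norm_num)
  have hL : (Δ (fun z => ⟪Ω z, Ω z⟫_ℝ)) y = 2 * ⟪(Δ Ω) y, Ω y⟫_ℝ + 2 * frobeniusNormSq (fderiv ℝ Ω y) :=
    laplacian_inner_self_eq hΩ y
  have hD : ∀ h, fderiv ℝ (fun z => ⟪Ω z, Ω z⟫_ℝ) y h = 2 * ⟪Ω y, fderiv ℝ Ω y h⟫_ℝ := fun h => by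
    rw [fderiv_inner_apply ℝ (hΩ1 y) (hΩ1 y) h, real_inner_comm (fderiv ℝ Ω y h) (Ω y)]; ring
  have hskew : ⟪Ω y, cross (EuclideanSpace.single 2 1) (Ω y)⟫_ℝ = 0 := by
    rw [cross_single_two_eq_rotGenL, rotGenL_apply, real_inner_comm, inner_rotGen_self]
  rw [hL, hD]
  simp only [inner_sub_right, inner_add_right, inner_smul_right, map_add, map_sub, map_smul, hskew, real_inner_comm (Ω y) ((Δ Ω) y)]
  rw [real_inner_comm (Ω y) (fderiv ℝ U y (Ω y))]
  ring

/-- **The vorticity magnitude of a steady profile is a subsolution away from strong strain.**  If `Ω ∈ C²` solves `𝒯_UΩ(y) = 0` and `q = |Ω|²`: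
`Δq(y) − Dq(y)[U(y) + ½y − αe₃×y] − 2q(y) + 2⟪DU(y)Ω(y), Ω(y)⟫ = 2‖DΩ(y)‖²_F`; hence if `⟪DU(y)Ω(y), Ω(y)⟫ ≤ s·q(y)` then
`−Δq(y) + Dq(y)[v(y)] + (2 − 2s)·q(y) ≤ 0` — the form `−Δq − Dq[b] + Vq ≤ 0` of the tree's weak maximum principle and of `exp_barrier_bound`, with drift `b = −v` and
`V = 2 − 2s ≥ 0` wherever the strain along `Ω` is `≤ 1`. -/
theorem vorticityOp_normSq_subsolution (α : ℝ) {U Ω : EuclideanSpace ℝ (Fin 3) → EuclideanSpace ℝ (Fin 3)} (hΩ : ContDiff ℝ 2 Ω)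
    {y : EuclideanSpace ℝ (Fin 3)} {s : ℝ} (hs : ⟪fderiv ℝ U y (Ω y), Ω y⟫_ℝ ≤ s * ⟪Ω y, Ω y⟫_ℝ)
    (hvort : α • (cross (EuclideanSpace.single 2 1) (Ω y) - fderiv ℝ Ω y (cross (EuclideanSpace.single 2 1) y)) + Ω y + (1/2:ℝ) • fderiv ℝ Ω y y
        - (Δ Ω) y + fderiv ℝ Ω y (U y) - fderiv ℝ U y (Ω y) = 0) :
    -(Δ (fun z => ⟪Ω z, Ω z⟫_ℝ)) y + fderiv ℝ (fun z => ⟪Ω z, Ω z⟫_ℝ) y (U y + (1/2:ℝ) • y - α • cross (EuclideanSpace.single 2 1) y)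
        + (2 - 2 * s) * ⟪Ω y, Ω y⟫_ℝ ≤ 0 := by
  have h := inner_vorticityOp_eq α U hΩ y
  rw [hvort, inner_zero_right, mul_zero] at h
  have hF : 0 ≤ frobeniusNormSq (fderiv ℝ Ω y) := frobeniusNormSq_nonneg _
  nlinarith

/-- **The vorticity of an exact profile solves the steady vorticity equation** (packaged once: `curl_lerayOp_of_isDivFree` + `curl ∇P = 0`).  If `U ∈ C³` is solenoidal and
`E_α(U) + ∇P = 0` pointwise with `P ∈ C²`, then `Ω = curl U` satisfies `𝒯_UΩ = 0` at every point. -/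
theorem vorticityOp_curl_eq_zero_of_exact_profile (α : ℝ) {U : EuclideanSpace ℝ (Fin 3) → EuclideanSpace ℝ (Fin 3)} {P : EuclideanSpace ℝ (Fin 3) → ℝ}
    (hU : ContDiff ℝ 3 U) (hdiv : VectorCalculus.IsDivFree U) (hP : ContDiff ℝ 2 P) (hprof : ∀ y, lerayOp α U y + gradient P y = 0)
    (y : EuclideanSpace ℝ (Fin 3)) :
    α • (cross (EuclideanSpace.single 2 1) (curl U y) - fderiv ℝ (curl U) y (cross (EuclideanSpace.single 2 1) y)) + curl U y
      + (1/2:ℝ) • fderiv ℝ (curl U) y y - (Δ (curl U)) y + fderiv ℝ (curl U) y (U y) - fderiv ℝ U y (curl U y) = 0 := by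
  have h1 := curl_lerayOp_of_isDivFree α hU hdiv y
  have h2 : curl (lerayOp α U) y = 0 := by
    have e : lerayOp α U = fun z => -(gradient P z) := by
      funext z; have := hprof z; exact eq_neg_of_add_eq_zero_left this
    rw [e]
    have hg := curl_gradient_eq_zero_holds P hP y
    rw [curl_eq_curlCLM] at hg ⊢
    rw [fderiv_fun_neg, map_neg, hg, neg_zero]
  rw [h2, ← add_sub_assoc] at h1
  exact h1.symm

/-- **The axial component of the (forward) vorticity operator is a SCALAR operator with the GOOD sign.**  For `Ω ∈ C²`, any `U`, any `y`, and `h(z) = ⟪Ω z, e₃⟫`: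
`⟪𝒯_UΩ(y), e₃⟫ = −Δh(y) + Dh(y)[U(y) + ½y − αe₃×y] + h(y) − ⟪DU(y)Ω(y), e₃⟫` — the rotation term `α⟪e₃×Ω, e₃⟫` vanishes identically, and the zeroth-order coefficient `+1`
has the sign for which `−Δ + v·∇ + 1` obeys the weak maximum principle directly: for a steady profile the AXIAL VORTICITY solves `−ΔΩ₃ + v·∇Ω₃ + Ω₃ = (Ω·∇)U₃`
(stretching/tilting source), cf. the adjoint twin `inner_vorticityAdjoint_single_two` (coefficient `+½` after the sign flip, wrong sign, needs the committor). -/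
theorem inner_vorticityOp_single_two (α : ℝ) (U : EuclideanSpace ℝ (Fin 3) → EuclideanSpace ℝ (Fin 3)) {Ω : EuclideanSpace ℝ (Fin 3) → EuclideanSpace ℝ (Fin 3)}
    (hΩ : ContDiff ℝ 2 Ω) (y : EuclideanSpace ℝ (Fin 3)) :
    ⟪α • (cross (EuclideanSpace.single 2 1) (Ω y) - fderiv ℝ Ω y (cross (EuclideanSpace.single 2 1) y)) + Ω y + (1/2:ℝ) • fderiv ℝ Ω y y
        - (Δ Ω) y + fderiv ℝ Ω y (U y) - fderiv ℝ U y (Ω y), EuclideanSpace.single 2 (1:ℝ)⟫_ℝ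
      = -(Δ (fun z => ⟪Ω z, EuclideanSpace.single 2 (1:ℝ)⟫_ℝ)) y
        + fderiv ℝ (fun z => ⟪Ω z, EuclideanSpace.single 2 (1:ℝ)⟫_ℝ) y (U y + (1/2:ℝ) • y - α • cross (EuclideanSpace.single 2 1) y)
        + ⟪Ω y, EuclideanSpace.single 2 (1:ℝ)⟫_ℝ - ⟪fderiv ℝ U y (Ω y), EuclideanSpace.single 2 (1:ℝ)⟫_ℝ := by
  have hΩ1 : Differentiable ℝ Ω := hΩ.differentiable (by norm_num)
  have hL : (Δ (fun z => ⟪Ω z, EuclideanSpace.single 2 (1:ℝ)⟫_ℝ)) y = ⟪(Δ Ω) y, EuclideanSpace.single 2 (1:ℝ)⟫_ℝ := by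
    have hc : ContDiff ℝ 2 (fun _ : EuclideanSpace ℝ (Fin 3) => (EuclideanSpace.single 2 (1:ℝ) : EuclideanSpace ℝ (Fin 3))) := contDiff_const
    rw [laplacian_inner_eq (EuclideanSpace.basisFun (Fin 3) ℝ) hΩ hc y, laplacian_const_eq_zero]
    simp
  have hD : ∀ h, fderiv ℝ (fun z => ⟪Ω z, EuclideanSpace.single 2 (1:ℝ)⟫_ℝ) y h = ⟪fderiv ℝ Ω y h, EuclideanSpace.single 2 (1:ℝ)⟫_ℝ := fun h => by
    rw [fderiv_inner_apply ℝ (hΩ1 y) (differentiableAt_const _) h]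
    simp
  have hskew : ⟪cross (EuclideanSpace.single 2 1) (Ω y), EuclideanSpace.single 2 (1:ℝ)⟫_ℝ = 0 := by
    rw [cross_single_two_eq_rotGenL, inner_rotGenL_left_eq_neg, rotGenL_apply, rotGen_single_two, inner_zero_right, neg_zero]
  rw [hL, hD]
  simp only [map_add, map_sub, map_smul, inner_sub_left, inner_add_left, inner_smul_left, hskew, RCLike.conj_to_real]
  ring

/-- **Axial vorticity equation of a steady profile.**  If `Ω ∈ C²` solves `𝒯_UΩ(y) = 0`, then with `h = ⟪Ω, e₃⟫`:
`−Δh(y) + Dh(y)[U(y) + ½y − αe₃×y] + h(y) = ⟪DU(y)Ω(y), e₃⟫`. -/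
theorem axial_vorticity_eq_of_vorticityOp_eq_zero (α : ℝ) {U Ω : EuclideanSpace ℝ (Fin 3) → EuclideanSpace ℝ (Fin 3)} (hΩ : ContDiff ℝ 2 Ω)
    {y : EuclideanSpace ℝ (Fin 3)}
    (hvort : α • (cross (EuclideanSpace.single 2 1) (Ω y) - fderiv ℝ Ω y (cross (EuclideanSpace.single 2 1) y)) + Ω y + (1/2:ℝ) • fderiv ℝ Ω y y
        - (Δ Ω) y + fderiv ℝ Ω y (U y) - fderiv ℝ U y (Ω y) = 0) :
    -(Δ (fun z => ⟪Ω z, EuclideanSpace.single 2 (1:ℝ)⟫_ℝ)) y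
        + fderiv ℝ (fun z => ⟪Ω z, EuclideanSpace.single 2 (1:ℝ)⟫_ℝ) y (U y + (1/2:ℝ) • y - α • cross (EuclideanSpace.single 2 1) y)
        + ⟪Ω y, EuclideanSpace.single 2 (1:ℝ)⟫_ℝ = ⟪fderiv ℝ U y (Ω y), EuclideanSpace.single 2 (1:ℝ)⟫_ℝ := by
  have h := inner_vorticityOp_single_two α U hΩ y
  rw [hvort, inner_zero_left] at h
  linarith

/-- **A-PRIORI BOUND FOR THE AXIAL VORTICITY OF A STEADY PROFILE (weak maximum principle, good sign).**  Let `D ⊆ ℝ³` be bounded open, `Ω ∈ C²` a solution of the steady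
vorticity equation `𝒯_UΩ = 0` on `D` whose frame field is bounded on `D` (`‖U + ½y − αe₃×y‖ ≤ B₀`) and whose tilting/stretching source is bounded on `D`
(`|⟪DU·Ω, e₃⟫| ≤ F`).  If `|Ω₃| ≤ M` on `∂D` then `|Ω₃| ≤ M + F` on `D̄`.  (Apply `PineauVicol2026.weak_maximum_principle` with `V ≡ 1` to `±Ω₃ − F`, which are subsolutions
by `axial_vorticity_eq_of_vorticityOp_eq_zero`.)  No size restriction on `D`, no smallness of the strain — the axial component is the one scalar of the vector problem
with an unconditional maximum principle. -/
theorem abs_axial_vorticity_le (α : ℝ) {U Ω : EuclideanSpace ℝ (Fin 3) → EuclideanSpace ℝ (Fin 3)} (hΩ : ContDiff ℝ 2 Ω)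
    {D : Set (EuclideanSpace ℝ (Fin 3))} (hD : IsOpen D) (hDb : Bornology.IsBounded D) {B₀ F M : ℝ} (hB₀ : 0 ≤ B₀) (hF : 0 ≤ F) (hM : 0 ≤ M)
    (hb : ∀ y ∈ D, ‖U y + (1/2:ℝ) • y - α • cross (EuclideanSpace.single 2 1) y‖ ≤ B₀)
    (hsrc : ∀ y ∈ D, |⟪fderiv ℝ U y (Ω y), EuclideanSpace.single 2 (1:ℝ)⟫_ℝ| ≤ F)
    (hvort : ∀ y ∈ D, α • (cross (EuclideanSpace.single 2 1) (Ω y) - fderiv ℝ Ω y (cross (EuclideanSpace.single 2 1) y)) + Ω y + (1/2:ℝ) • fderiv ℝ Ω y y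
        - (Δ Ω) y + fderiv ℝ Ω y (U y) - fderiv ℝ U y (Ω y) = 0)
    (hbdry : ∀ y ∈ frontier D, |⟪Ω y, EuclideanSpace.single 2 (1:ℝ)⟫_ℝ| ≤ M) :
    ∀ y ∈ closure D, |⟪Ω y, EuclideanSpace.single 2 (1:ℝ)⟫_ℝ| ≤ M + F := by
  have he : ‖(EuclideanSpace.single 2 (1:ℝ) : EuclideanSpace ℝ (Fin 3))‖ = 1 := by rw [PiLp.norm_single, norm_one]
  have hh : ContDiff ℝ 2 (fun z => ⟪Ω z, EuclideanSpace.single 2 (1:ℝ)⟫_ℝ) := hΩ.inner ℝ contDiff_const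
  -- the two shifted functions `σ·Ω₃ − F`, `σ = ±1`
  have key : ∀ σ : ℝ, σ = 1 ∨ σ = -1 → ∀ y ∈ closure D, σ * ⟪Ω y, EuclideanSpace.single 2 (1:ℝ)⟫_ℝ - F ≤ M := by
    intro σ hσ
    have hφ : ContDiff ℝ 2 (fun z => σ * ⟪Ω z, EuclideanSpace.single 2 (1:ℝ)⟫_ℝ - F) := (contDiff_const.mul hh).sub contDiff_const
    refine PineauVicol2026.weak_maximum_principle hD hDb he hφ (b := fun y => -(U y + (1/2:ℝ) • y - α • cross (EuclideanSpace.single 2 1) y))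
      (V := fun _ => (1:ℝ)) (B := B₀) (V₀ := 1) hB₀ zero_le_one (fun y hy => by rw [norm_neg]; exact hb y hy) (fun _ _ => zero_le_one) (fun _ _ => le_rfl)
      ?_ hM (fun y hy => ?_)
    · intro y hy
      have hax := axial_vorticity_eq_of_vorticityOp_eq_zero α hΩ (hvort y hy)
      -- Laplacian and derivative of the shifted function
      have hL : (Δ (fun z => σ * ⟪Ω z, EuclideanSpace.single 2 (1:ℝ)⟫_ℝ - F)) y = σ * (Δ (fun z => ⟪Ω z, EuclideanSpace.single 2 (1:ℝ)⟫_ℝ)) y := by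
        have e1 : (fun z => σ * ⟪Ω z, EuclideanSpace.single 2 (1:ℝ)⟫_ℝ - F) = (σ • fun z => ⟪Ω z, EuclideanSpace.single 2 (1:ℝ)⟫_ℝ) - fun _ => F := by
          funext z; simp [smul_eq_mul]
        have hc : ContDiffAt ℝ 2 (fun _ : EuclideanSpace ℝ (Fin 3) => F) y := contDiffAt_const
        have hs : ContDiffAt ℝ 2 (σ • fun z => ⟪Ω z, EuclideanSpace.single 2 (1:ℝ)⟫_ℝ) y := by
          have : (σ • fun z => ⟪Ω z, EuclideanSpace.single 2 (1:ℝ)⟫_ℝ) = fun z => σ * ⟪Ω z, EuclideanSpace.single 2 (1:ℝ)⟫_ℝ := by funext z; simp [smul_eq_mul]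
          rw [this]; exact (contDiff_const.mul hh).contDiffAt
        rw [e1, hs.laplacian_sub hc, InnerProductSpace.laplacian_smul σ (hh.contDiffAt (x := y)), laplacian_const_eq_zero, sub_zero, smul_eq_mul]
      have hDf : ∀ w, fderiv ℝ (fun z => σ * ⟪Ω z, EuclideanSpace.single 2 (1:ℝ)⟫_ℝ - F) y w = σ * fderiv ℝ (fun z => ⟪Ω z, EuclideanSpace.single 2 (1:ℝ)⟫_ℝ) y w := by
        intro w
        have hd : DifferentiableAt ℝ (fun z => ⟪Ω z, EuclideanSpace.single 2 (1:ℝ)⟫_ℝ) y := hh.differentiable (by norm_num) y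
        rw [fderiv_sub_const, fderiv_const_mul hd]
        simp only [FunLike.coe_smul, Pi.smul_apply, smul_eq_mul]
      rw [hL, hDf, map_neg]
      have h1 := hsrc y hy
      have h2 := abs_le.mp h1
      rcases hσ with h | h <;> subst h <;> nlinarith
    · have := abs_le.mp (hbdry y hy)
      rcases hσ with h | h <;> subst h <;> nlinarith
  intro y hy
  have h1 := key 1 (Or.inl rfl) y hy
  have h2 := key (-1) (Or.inr rfl) y hy
  rw [abs_le]; constructor <;> linarith

end Summit.NavierStokesRegularity.NavierStokesRegularity.Theorems.DefectColumnGate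

end
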